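import Summits.ValiantsHypothesis.ValiantsHypothesis.Theorems.GrenetZeonDualUnipotentThreeHalvesLongMassNilSpaceKolchin
import Summits.ValiantsHypothesis.ValiantsHypothesis.Theorems.GrenetZeonDualUnipotentThreeHalvesLongMassNilSpaceLevitzki
import Summits.ValiantsHypothesis.ValiantsHypothesis.Theorems.GrenetZeonDualUnipotentThreeHalvesLongMassPerPencilPrice

/-!
# `GrenetZeon.TwoDimCoefficients` (stmt-ValiantsHypothesis-8062), stub `stub_dualUnipotent` — the KOLCHIN and LEVITZKI RUNGS:
# `per_n = tr(N^{n−1} M)` whose nilpotent values generate a nil SEMIGROUP (or whose unipotent values generate a unipotent MONOID) forces `m ≳ n^{3/2}/2`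

leafhand-val-grenetzeon-2 gen31 (32nd hand), 2026-09-01; 8062-side twins of the (c)-rows ✓ `…LongMassNilSpaceKolchin` (Kolchin's criterion,
Radjavi–Rosenthal Thm. 2.1.8) and ✓ `…LongMassNilSpaceLevitzki` (Levitzki's criterion, Thm. 2.1.7), through the per-pencil price bridge
✓ `PerPencilPrice.le_of_relCert_of_perPoly_eq_trace`.

The dual-unipotent model of the crux is a UNIPOTENT pencil `A(x) = A(0)(1 + L(x))`; its normal form (✓ `exists_nilpotent_pencil_of_dualUnipotentRepr`)
is `per_n = tr(N^{n−1}·M)` with every value `N(x)` NILPOTENT.  The two semigroup-theoretic strengthenings of «every value nilpotent / unipotent»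
are priced here:

* ★ `le_of_perPoly_eq_trace_values_semigroup_nil` — LEVITZKI RUNG: if every finite product `N(x₀)N(x₁)⋯N(x_s)` of values is nilpotent, then
  `n(n−1) ≤ 2⌊√n⌋·m` (`m ≳ n^{3/2}/2`).  Contrapositive ★ `exists_prod_values_not_isNilpotent`: a width-`o(n^{3/2})` model of `per_n` has a
  NON-nilpotent product of nilpotent values.
* ★ `le_of_perPoly_eq_trace_monoid_unipotent` — KOLCHIN RUNG: if the values of `N` lie in a space `V` whose monoid `⟨1 + V⟩` is unipotent, the same
  bound; contrapositive `exists_prod_not_unipotent`: some product `(1 + X₁)⋯(1 + X_s)`, `X_t ∈ V`, has an eigenvalue `≠ 1`.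

Honest framing.  Helpers (`--supports stmt-ValiantsHypothesis-8062`); nothing here proves `DualUnipotentBound`, `TwoDimCoefficients`, 24318 or
`VP ≠ VNP` — OPEN / NOT proved.  Def-free, no sorry. [cite: RadjaviRosenthal2000, Thm. 2.1.7–2.1.8, p0035]
-/

set_option linter.dupNamespace false
set_option autoImplicit false

noncomputable section

namespace Summit.ValiantsHypothesis.ValiantsHypothesis.Theorems.GrenetZeon.NilSpaceLevitzki

open MvPolynomial Matrix
open scoped BigOperators
open Literature.Computability.AlgebraicComplexity (perPoly)
open Summit.ValiantsHypothesis.ValiantsHypothesis.Cruxes.TwoDimCoefficients.DimTwoCases (AffMat IsAffine)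
open Summit.ValiantsHypothesis.ValiantsHypothesis.Theorems.GrenetZeon.SlowCore (RelCert)
open Summit.ValiantsHypothesis.ValiantsHypothesis.Theorems.GrenetZeon.PerPencilPrice (le_of_relCert_of_perPoly_eq_trace)
open Summit.ValiantsHypothesis.ValiantsHypothesis.Theorems.GrenetZeon.NilSpaceKolchin
  (relCert_of_valueSpace_monoid_unipotent)

variable {n m : ℕ}

/-- ★ **LEVITZKI RUNG.**  `per_n = tr(N^{n−1}·M)` with affine `m × m` pencils, every finite product of VALUES of `N` nilpotent ⇒
`n(n−1) ≤ 2⌊√n⌋·m`. [cite: RadjaviRosenthal2000, Thm. 2.1.7 (Levitzki's Theorem), p0035] -/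
theorem le_of_perPoly_eq_trace_values_semigroup_nil (N M : AffMat n m) (hN : IsAffine N) (hM : IsAffine M)
    (hper : perPoly (Fin n) ℂ = (N ^ (n - 1) * M).trace)
    (hnil : ∀ (s : ℕ) (xs : Fin (s + 1) → (Fin n × Fin n → ℂ)),
      IsNilpotent ((List.ofFn fun t => N.map (MvPolynomial.eval (xs t))).prod)) :
    n * (n - 1) ≤ 2 * (Nat.sqrt n * m) :=
  le_of_relCert_of_perPoly_eq_trace N M hM hper (relCert_of_values_semigroup_nil N hN hnil)

/-- ★ **A cheap model has a non-nilpotent product of nilpotent values** (contrapositive of the Levitzki rung). [cite: RadjaviRosenthal2000, Thm. 2.1.7, p0035] -/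
theorem exists_prod_values_not_isNilpotent (N M : AffMat n m) (hN : IsAffine N) (hM : IsAffine M)
    (hper : perPoly (Fin n) ℂ = (N ^ (n - 1) * M).trace) (hsmall : 2 * (Nat.sqrt n * m) < n * (n - 1)) :
    ∃ (s : ℕ) (xs : Fin (s + 1) → (Fin n × Fin n → ℂ)),
      ¬ IsNilpotent ((List.ofFn fun t => N.map (MvPolynomial.eval (xs t))).prod) := by
  by_contra h
  push Not at h
  exact absurd (le_of_perPoly_eq_trace_values_semigroup_nil N M hN hM hper h) (not_le.mpr hsmall)

/-- ★ **KOLCHIN RUNG.**  `per_n = tr(N^{n−1}·M)`, values of `N` in a space `V` whose monoid `⟨1 + V⟩` is unipotent ⇒ `n(n−1) ≤ 2⌊√n⌋·m`.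
[cite: RadjaviRosenthal2000, Thm. 2.1.8 (Kolchin's Theorem), p0035] -/
theorem le_of_perPoly_eq_trace_monoid_unipotent (N M : AffMat n m) (hN : IsAffine N) (hM : IsAffine M)
    (hper : perPoly (Fin n) ℂ = (N ^ (n - 1) * M).trace)
    (V : Submodule ℂ (Matrix (Fin m) (Fin m) ℂ)) (hV : ∀ x : Fin n × Fin n → ℂ, N.map (MvPolynomial.eval x) ∈ V)
    (hU : ∀ (s : ℕ) (w : Fin s → Matrix (Fin m) (Fin m) ℂ), (∀ t, w t ∈ V) →
      IsNilpotent ((List.ofFn fun t => (1 : Matrix (Fin m) (Fin m) ℂ) + w t).prod - 1)) :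
    n * (n - 1) ≤ 2 * (Nat.sqrt n * m) :=
  le_of_relCert_of_perPoly_eq_trace N M hM hper (relCert_of_valueSpace_monoid_unipotent N hN V hV hU)

/-- **A cheap model has a non-unipotent product of unipotent values** (contrapositive of the Kolchin rung). [cite: RadjaviRosenthal2000, Thm. 2.1.8, p0035] -/
theorem exists_prod_not_unipotent (N M : AffMat n m) (hN : IsAffine N) (hM : IsAffine M)
    (hper : perPoly (Fin n) ℂ = (N ^ (n - 1) * M).trace)
    (V : Submodule ℂ (Matrix (Fin m) (Fin m) ℂ)) (hV : ∀ x : Fin n × Fin n → ℂ, N.map (MvPolynomial.eval x) ∈ V)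
    (hsmall : 2 * (Nat.sqrt n * m) < n * (n - 1)) :
    ∃ (s : ℕ) (w : Fin s → Matrix (Fin m) (Fin m) ℂ), (∀ t, w t ∈ V) ∧
      ¬ IsNilpotent ((List.ofFn fun t => (1 : Matrix (Fin m) (Fin m) ℂ) + w t).prod - 1) := by
  by_contra h
  push Not at h
  exact absurd (le_of_perPoly_eq_trace_monoid_unipotent N M hN hM hper V hV fun s w hw => h s w hw) (not_le.mpr hsmall)

end Summit.ValiantsHypothesis.ValiantsHypothesis.Theorems.GrenetZeon.NilSpaceLevitzki

end
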